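import Literature.MathematicalPhysics.QuantumLattice.InfVolFermionStateLatticeMapPullback
import HarnessLib

/-!
# The fixed-filling energy density of the `t–t'–t''` Hubbard model is `(16/π²)`-Lipschitz in `t''`

Topic `Literature/MathematicalPhysics/QuantumLattice` (family `hubbard`). Consumer form of the kinematic
third-neighbour row `|K₃(σ)| ≤ 16/π²` (`IsTranslationInvariant.abs_meanEnergy_axialRange2Hopping_le`,
`InfVolFermionStateLatticeMapPullback.lean`) through the class-constant pencil Lipschitz bound
`FermionInteraction.abs_infMeanEnergyOn_pencil_sub_le` (`HubbardTTPrimeTPPFillingTransport.lean`): for every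
realised filling `0 < ρ < 2`, all `t, t', U` and all `t'', s''`,
`|e_ρ(t,t',t'',U) − e_ρ(t,t',s'',U)| ≤ (16/π²)|t'' − s''|`, `e_ρ(t,t',t'',U) =
tiGroundEnergyDensityAt (hubbardTT'T''FermionInteraction t t' t'' U) 2 ρ` — the LIPSCHITZ form the
`S1/S2` seam consumes (`holdsOn_inflate_of_lipschitz`, cell `pub/hubbard-downfold`: object-M allowance
`(16/π²)·max|t''/t| ≈ 1.6212·m` instead of the operator-norm `4·m`/`8·m`), plus the transport of a word
certified on a `t''`-interval to a wider one. Everything is PROVED; no definition, no named fact, no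
number, no `sorry`. HONEST SCOPE: kinematic constant, density-blind within `(0,2)`; fixed-filling objects
only (the unconstrained `tiGroundEnergyDensity` also ranges over the fillings `0` and `2`, not covered by
the row as stated).

## References
* E. H. Lieb, M. Loss, Duke Math. J. 71 (1993) 337, §8 Thm. 8.2 (bathtub). [cite: LiebLoss1993, §8, Theorem 8.2]
* R. B. Israel, *Convexity in the Theory of Lattice Gases* (1979), Thm. I.3.4 (Lipschitz continuity in the
  interaction). [cite: Israel1979, Thm. I.3.4]
-/

noncomputable section

namespace Literature.MathematicalPhysics.QuantumLattice

open Matrix Finset HubbardWave0 Literature.Probability.LatticeModels ThermodynamicLimit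
open scoped ComplexOrder BigOperators

/-- **`(16/π²)`-Lipschitz continuity in `t''` at fixed filling**: for `0 < ρ < 2` and all `t, t', U, t'',
s''`, `|e_ρ(t,t',t'',U) − e_ρ(t,t',s'',U)| ≤ (16/π²)|t'' − s''|`. [cite: Israel1979, Thm. I.3.4] -/
theorem abs_tiGroundEnergyDensityAt_tpp_sub_le_kinematic (t t' U : ℝ) {ρ : ℝ} (hρ0 : 0 < ρ) (hρ2 : ρ < 2)
    (t'' s'' : ℝ) :
    |(hubbardTT'T''FermionInteraction t t' t'' U).tiGroundEnergyDensityAt 2 ρ -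
        (hubbardTT'T''FermionInteraction t t' s'' U).tiGroundEnergyDensityAt 2 ρ| ≤
      16 / Real.pi ^ 2 * |t'' - s''| := by
  obtain ⟨ω, hω, hρ⟩ := exists_isTranslationInvariant_density_eq hρ0 hρ2
  exact FermionInteraction.abs_infMeanEnergyOn_pencil_sub_le _ _ 2
    (S := {σ : InfVolFermionState 2 | σ.IsTranslationInvariant ∧ σ.density = ρ}) ⟨ω, ⟨hω, hρ⟩⟩
    (fun σ hσ => hσ.1.abs_meanEnergy_axialRange2Hopping_le (by rw [hσ.2]; exact hρ0)
      (by rw [hσ.2]; exact hρ2)) t'' s''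

/-- **One-sided form**: `e_ρ(t,t',s'',U) − (16/π²)|t'' − s''| ≤ e_ρ(t,t',t'',U)`.
[cite: Israel1979, Thm. I.3.4] -/
theorem tiGroundEnergyDensityAt_tpp_sub_kinematic_le (t t' U : ℝ) {ρ : ℝ} (hρ0 : 0 < ρ) (hρ2 : ρ < 2)
    (t'' s'' : ℝ) :
    (hubbardTT'T''FermionInteraction t t' s'' U).tiGroundEnergyDensityAt 2 ρ - 16 / Real.pi ^ 2 * |t'' - s''| ≤
      (hubbardTT'T''FermionInteraction t t' t'' U).tiGroundEnergyDensityAt 2 ρ := by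
  have h := abs_sub_le_iff.1 (abs_tiGroundEnergyDensityAt_tpp_sub_le_kinematic t t' U hρ0 hρ2 t'' s'')
  linarith [h.2]

/-- **Window transport along `t''`**: a window `lo ≤ e_ρ(t,t',s'',U) ≤ hi` certified at `s''` gives
`lo − (16/π²)|t'' − s''| ≤ e_ρ(t,t',t'',U) ≤ hi + (16/π²)|t'' − s''|` at every `t''`.
[cite: Israel1979, Thm. I.3.4] -/
theorem tiGroundEnergyDensityAt_tpp_mem_Icc_of_window (t t' U : ℝ) {ρ : ℝ} (hρ0 : 0 < ρ) (hρ2 : ρ < 2)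
    {s'' lo hi : ℝ} (hlo : lo ≤ (hubbardTT'T''FermionInteraction t t' s'' U).tiGroundEnergyDensityAt 2 ρ)
    (hhi : (hubbardTT'T''FermionInteraction t t' s'' U).tiGroundEnergyDensityAt 2 ρ ≤ hi) (t'' : ℝ) :
    (hubbardTT'T''FermionInteraction t t' t'' U).tiGroundEnergyDensityAt 2 ρ ∈
      Set.Icc (lo - 16 / Real.pi ^ 2 * |t'' - s''|) (hi + 16 / Real.pi ^ 2 * |t'' - s''|) := by
  have h := abs_sub_le_iff.1 (abs_tiGroundEnergyDensityAt_tpp_sub_le_kinematic t t' U hρ0 hρ2 t'' s'')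
  constructor <;> linarith [h.1, h.2]

/-- **Box form**: a window certified at `s''` holds, inflated by `(16/π²)·r`, at every `t''` with
`|t'' − s''| ≤ r`. [cite: Israel1979, Thm. I.3.4] -/
theorem tiGroundEnergyDensityAt_tpp_mem_Icc_of_window_of_abs_le (t t' U : ℝ) {ρ : ℝ} (hρ0 : 0 < ρ)
    (hρ2 : ρ < 2) {s'' lo hi r : ℝ}
    (hlo : lo ≤ (hubbardTT'T''FermionInteraction t t' s'' U).tiGroundEnergyDensityAt 2 ρ)
    (hhi : (hubbardTT'T''FermionInteraction t t' s'' U).tiGroundEnergyDensityAt 2 ρ ≤ hi) {t'' : ℝ}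
    (hr : |t'' - s''| ≤ r) :
    (hubbardTT'T''FermionInteraction t t' t'' U).tiGroundEnergyDensityAt 2 ρ ∈
      Set.Icc (lo - 16 / Real.pi ^ 2 * r) (hi + 16 / Real.pi ^ 2 * r) := by
  have h := tiGroundEnergyDensityAt_tpp_mem_Icc_of_window t t' U hρ0 hρ2 hlo hhi t''
  have hk : 16 / Real.pi ^ 2 * |t'' - s''| ≤ 16 / Real.pi ^ 2 * r :=
    mul_le_mul_of_nonneg_left hr (by positivity)
  exact ⟨by linarith [h.1], by linarith [h.2]⟩

end Literature.MathematicalPhysics.QuantumLattice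

end
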